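import Literature.MathematicalPhysics.KineticTheory.HardSphereBBGKYLiouvilleDrift
import Literature.MathematicalPhysics.KineticTheory.HardSphereEntranceProofs
import HarnessLib

/-!
# Boundary data for the BBGKY collision operator: solving `C_{s,s+1} h = K`

Seventh file of the proof of `Literature.MathematicalPhysics.KineticTheory.bbgky_hierarchy_of_liouville`
(**hilbert6.S07**; plan in `HardSphereBBGKYLiouvilleFlow`). The collision operator
`bbgkyOp G ε N s` of GST 2013 (4.3.5)–(4.3.6) reads its argument, with non-zero weight, only at
approaching contact configurations of a pair `(i, s+1)` — a null set disjoint from every good set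
(`LiouvilleBBGKY`). Given a tagged index `i₀`, a measurable `K : Config s → ℝ` with
`|K| ≤ A₀ e^{-b‖v_{i₀}‖²}`, we construct explicit data `h : Config (s+1) → ℝ`, supported on contact
configurations of the pair `(i₀, s+1)`, with

  `bbgkyOp G ε N s h = 1_{Sbadᶜ} · K`   (`exists_boundaryData`),

where `Sbad` is the null set of `HardSphereBBGKYLiouvilleDrift.exists_badSet`. The data are
`h(Y; x_{i₀} + εω, v) = 1[r > 0] Λ(Y, rω) e^{-(‖v - v_{i₀}‖² - r²)} / (r M)`, `r = ⟪ω, v_{i₀} - v⟫`,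
with `Λ(Y, u) = -(θ(u)/c) ∑_n K(S_{nu} Y)` the telescoping potential along velocity shifts of
particle `i₀` (`θ` a normalised shell cut-off, `c = (N-s) ε^{d-1}`, `M` the Gaussian mass of a
hyperplane): in the cylindrical coordinates `v - v_{i₀} = a ω + ι u` adapted to `ω`
(`exists_axisDecomposition`) the loss term at `Y` integrates `Λ(Y, rω)` over `r > 0`, the gain
term — whose configurations carry the reflected velocities `(v_{i₀} + rω, v - rω)` — integrates
`Λ(S_{rω} Y, rω)`, and `Λ(S_u Y, u) - Λ(Y, u) = θ(u) K(Y)/c` telescopes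
(`tsum_shift_series_succ`); the collision terms of the other pairs vanish off `Sbad`.

This is what the *statement* of the hierarchy needs at level `s` (free boundary values on a
null set); it is not the physical trace of the `(s+1)`-marginal (for which see `MildBBGKYae` in
`LiouvilleBBGKY`).

Theorems only; no definition and no named fact is introduced.

## References

* I. Gallagher, L. Saint-Raymond, B. Texier, *From Newton to Boltzmann*, EMS (2013),
  arXiv:1208.5753, (4.3.5)–(4.3.6) (the collision operator and its gain / loss configurations).
* C. Cercignani, R. Illner, M. Pulvirenti, *The Mathematical Theory of Dilute Gases*, Springer
  (1994), §4.3 (4.3.9).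
-/

open MeasureTheory Set Filter Topology Metric Module
open scoped ENNReal InnerProductSpace

namespace Literature.MathematicalPhysics.KineticTheory

open Literature.Analysis.FluidPDE

noncomputable section

variable {d : Type*} [Fintype d]

/-! ## §1. Cylindrical coordinates adapted to a direction -/

section Axis

/-- **Integration in cylindrical coordinates adapted to `ω`.** For a unit vector `ω` of `ℝ^d`
(`d = m + 1`), a measurable `F : ℝ → ℝ` and any `v₀`,
`∫ F(⟪ω, v - v₀⟫) e^{-(‖v - v₀‖² - ⟪ω, v - v₀⟫²)} dv = (∫ F) · ∫_{ℝ^m} e^{-‖u‖²} du`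
(translation invariance, the axis decomposition `v - v₀ = a ω + ι u` of
`exists_axisDecomposition`, and `integral_prod_mul`). [folklore] -/
theorem integral_axis_eq {m : ℕ} (hm : Fintype.card d = m + 1) (ω : EuclideanSpace ℝ d)
    (hω : ‖ω‖ = 1) (v₀ : EuclideanSpace ℝ d) {F : ℝ → ℝ} (hF : Measurable F) :
    ∫ v : EuclideanSpace ℝ d, F ⟪ω, v - v₀⟫_ℝ * Real.exp (-(‖v - v₀‖ ^ 2 - ⟪ω, v - v₀⟫_ℝ ^ 2)) =
      (∫ a : ℝ, F a) * ∫ u : EuclideanSpace ℝ (Fin m), Real.exp (-‖u‖ ^ 2) := by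
  have hn : finrank ℝ (EuclideanSpace ℝ d) = m + 1 := by rw [finrank_euclideanSpace, hm]
  obtain ⟨ι, hι, hmp⟩ := exists_axisDecomposition hn ω hω
  -- translate
  have h1 : ∫ v : EuclideanSpace ℝ d, F ⟪ω, v - v₀⟫_ℝ * Real.exp (-(‖v - v₀‖ ^ 2 - ⟪ω, v - v₀⟫_ℝ ^ 2)) =
      ∫ w : EuclideanSpace ℝ d, F ⟪ω, w⟫_ℝ * Real.exp (-(‖w‖ ^ 2 - ⟪ω, w⟫_ℝ ^ 2)) := by
    have := integral_add_left_eq_self (μ := (volume : Measure (EuclideanSpace ℝ d)))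
      (fun w => F ⟪ω, w - v₀⟫_ℝ * Real.exp (-(‖w - v₀‖ ^ 2 - ⟪ω, w - v₀⟫_ℝ ^ 2))) v₀
    simp only [add_sub_cancel_left] at this
    rw [← this]
  rw [h1]
  -- the axis decomposition
  have hmeas : AEStronglyMeasurable (fun w : EuclideanSpace ℝ d => F ⟪ω, w⟫_ℝ * Real.exp (-(‖w‖ ^ 2 - ⟪ω, w⟫_ℝ ^ 2)))
      (volume : Measure (EuclideanSpace ℝ d)) := by
    refine Measurable.aestronglyMeasurable ?_
    refine (hF.comp (measurable_const.inner measurable_id)).mul ?_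
    fun_prop
  rw [← hmp.map_eq, integral_map hmp.measurable.aemeasurable (by rw [hmp.map_eq]; exact hmeas)]
  have hpt : ∀ p : ℝ × EuclideanSpace ℝ (Fin m),
      F ⟪ω, p.1 • ω + ι p.2⟫_ℝ * Real.exp (-(‖p.1 • ω + ι p.2‖ ^ 2 - ⟪ω, p.1 • ω + ι p.2⟫_ℝ ^ 2)) =
        F p.1 * Real.exp (-‖p.2‖ ^ 2) := by
    intro p
    obtain ⟨hnorm, hinner⟩ := norm_axis_add hω ι hι p.1 p.2
    rw [hinner, hnorm, Real.sq_sqrt (by positivity)]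
    congr 2
    ring
  simp only [hpt]
  exact integral_prod_mul (μ := (volume : Measure ℝ)) (ν := (volume : Measure (EuclideanSpace ℝ (Fin m))))
    F (fun u => Real.exp (-‖u‖ ^ 2))

/-- The Gaussian mass of a hyperplane is positive: `0 < ∫_{ℝ^m} e^{-‖u‖²} du`. [folklore] -/
theorem gaussian_hyperplane_pos (m : ℕ) : 0 < ∫ u : EuclideanSpace ℝ (Fin m), Real.exp (-‖u‖ ^ 2) := by
  have h := GaussianFourier.integral_rexp_neg_mul_sq_norm (V := EuclideanSpace ℝ (Fin m)) (b := 1) one_pos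
  simp only [div_one] at h
  rw [show (fun u : EuclideanSpace ℝ (Fin m) => Real.exp (-‖u‖ ^ 2)) =
    fun u => Real.exp (-1 * ‖u‖ ^ 2) by funext u; ring_nf]
  rw [GaussianFourier.integral_rexp_neg_mul_sq_norm (V := EuclideanSpace ℝ (Fin m)) one_pos]
  positivity

end Axis

/-! ## §2. Elastic reflection with a unit impact direction -/

section Reflect

/-- For a unit `ω`, `reflectVel ω (v₀, v) = (v₀ + ⟪ω, v - v₀⟫ ω, v - ⟪ω, v - v₀⟫ ω)`. [folklore] -/
theorem reflectVel_unit (ω : EuclideanSpace ℝ d) (hω : ‖ω‖ = 1) (v₀ v : EuclideanSpace ℝ d) :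
    reflectVel ω (v₀, v) = (v₀ + ⟪ω, v - v₀⟫_ℝ • ω, v - ⟪ω, v - v₀⟫_ℝ • ω) := by
  have h1 : ⟪v₀ - v, ω⟫_ℝ / ‖ω‖ ^ 2 = -⟪ω, v - v₀⟫_ℝ := by
    rw [hω, one_pow, div_one, real_inner_comm, ← inner_neg_right, neg_sub]
  unfold reflectVel
  rw [Prod.mk.injEq]
  simp only [h1, neg_smul]
  constructor
  · rw [sub_neg_eq_add]
  · rw [← sub_eq_add_neg]

end Reflect

/-! ## §3. The boundary data and their reads -/

section Torus

variable {ε : ℝ} {s N : ℕ}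

/-- The minimal-image vector from `x₀` to `x₀ + εω` is `εω` whenever `reprSym (proj (εω)) = εω`. [folklore] -/
theorem reprSym_translate_sub (x₀ : UnitAddTorus d) {u : EuclideanSpace ℝ d}
    (hu : Torus.reprSym (Literature.Analysis.FunctionSpaces.Torus.proj u) = u) :
    Torus.reprSym ((Torus.geometry d).translate x₀ u - x₀) = u := by
  rw [Torus.geometry_translate, add_sub_cancel_left, hu]

variable {s : ℕ}

/-- **The representation lemma (boundary data solving `C_{s,s+1} h = K` off a null set).** On
the flat torus with `0 < ε`, `card d ≥ 1`, let `s < N`, `i₀ : Fin s`, `b > 0`, and assume the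
directions `ω` with `reprSym (proj (εω)) ≠ εω` are `σ`-null (automatic for `ε < 1/2`; for
`ε = 1/2` it holds when `card d ≥ 2`). Let `Sbad` be the null set of
`HardSphereBBGKYLiouvilleDrift.exists_badSet`. Then for every measurable `K : Config s → ℝ` with
`|K(Y)| ≤ A₀ e^{-b ‖v_{i₀}‖²}` there is `h : Config (s+1) → ℝ` such that

* `bbgkyOp G ε N s h Y = K Y` for `Y ∉ Sbad` and `= 0` for `Y ∈ Sbad`;
* `h Z ≠ 0` only if the added particle touches particle `i₀`: `dist(x_{s+1}, x_{i₀}) = ε`.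

Construction and proof in the module docstring (cylindrical coordinates adapted to `ω`,
reflected velocities of the gain configurations, telescoping along velocity shifts; the
collision terms of the pairs `(i, s+1)`, `i ≠ i₀`, vanish off `Sbad`). [folklore] -/
theorem exists_boundaryData (hε : 0 < ε) (hd : 1 ≤ Fintype.card d) {s N : ℕ} (hsN : s < N)
    (i₀ : Fin s) {A₀ b : ℝ} (hb : 0 < b)
    (hBadω : sphereMeasure {ω : sphere (0 : EuclideanSpace ℝ d) 1 |
      Torus.reprSym (Literature.Analysis.FunctionSpaces.Torus.proj (ε • (ω : EuclideanSpace ℝ d))) ≠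
        ε • (ω : EuclideanSpace ℝ d)} = 0)
    {K : Config s d (UnitAddTorus d) → ℝ} (hKm : Measurable K)
    (hK : ∀ Y, |K Y| ≤ A₀ * Real.exp (-b * ‖(Y i₀).2‖ ^ 2)) :
    ∃ hbd : Config (s + 1) d (UnitAddTorus d) → ℝ,
      (∀ Y : Config s d (UnitAddTorus d),
        bbgkyOp (Torus.geometry d) ε N s hbd Y =
          {Y : Config s d (UnitAddTorus d) | ∃ i : Fin s, i ≠ i₀ ∧
            sphereMeasure {ω : sphere (0 : EuclideanSpace ℝ d) 1 |
              Torus.euclidDist ((Torus.geometry d).translate (Y i).1 (ε • (ω : EuclideanSpace ℝ d))) (Y i₀).1 = ε} ≠ 0}ᶜ.indicator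
            K Y) ∧
      (∀ Z : Config (s + 1) d (UnitAddTorus d), hbd Z ≠ 0 →
        Torus.euclidDist (Z (Fin.last s)).1 (Z (Fin.castSucc i₀)).1 = ε) := by
  classical
  /- ### constants -/
  obtain ⟨m', hm'⟩ : ∃ m' : ℕ, Fintype.card d = m' + 1 := ⟨Fintype.card d - 1, by omega⟩
  haveI : Nonempty d := Fintype.card_pos_iff.1 hd
  haveI : Nontrivial (EuclideanSpace ℝ d) := inferInstance
  haveI hσfin : IsFiniteMeasure (sphereMeasure : Measure (sphere (0 : EuclideanSpace ℝ d) 1)) := by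
    unfold sphereMeasure; infer_instance
  -- total surface measure
  obtain ⟨mσ, hmσ⟩ : ∃ mσ : ℝ, mσ = (sphereMeasure : Measure (sphere (0 : EuclideanSpace ℝ d) 1)).real univ :=
    ⟨_, rfl⟩
  have hmσ0 : 0 < mσ := by
    rw [hmσ, Measure.real, ENNReal.toReal_pos_iff]
    refine ⟨pos_iff_ne_zero.2 ?_, measure_lt_top _ _⟩
    intro h
    have h' := Measure.measure_univ_eq_zero.1 h
    unfold sphereMeasure at h'
    exact Measure.toSphere_ne_zero _ h'
  -- Gaussian mass of a hyperplane
  obtain ⟨M, hM⟩ : ∃ M : ℝ, M = ∫ u : EuclideanSpace ℝ (Fin m'), Real.exp (-‖u‖ ^ 2) := ⟨_, rfl⟩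
  have hM0 : 0 < M := by rw [hM]; exact gaussian_hyperplane_pos m'
  -- the prefactor of the collision operator
  obtain ⟨c, hc⟩ : ∃ c : ℝ, c = ((N - s : ℕ) : ℝ) * ε ^ (Fintype.card d - 1) := ⟨_, rfl⟩
  have hc0 : 0 < c := by
    rw [hc]
    have : (0 : ℝ) < ((N - s : ℕ) : ℝ) := by exact_mod_cast Nat.sub_pos_of_lt hsN
    positivity
  -- the bad set
  obtain ⟨Sbad, hSbad⟩ : ∃ Sbad : Set (Config s d (UnitAddTorus d)), Sbad =
      {Y : Config s d (UnitAddTorus d) | ∃ i : Fin s, i ≠ i₀ ∧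
        sphereMeasure {ω : sphere (0 : EuclideanSpace ℝ d) 1 |
          Torus.euclidDist ((Torus.geometry d).translate (Y i).1 (ε • (ω : EuclideanSpace ℝ d))) (Y i₀).1 = ε} ≠ 0} :=
    ⟨_, rfl⟩
  have hSbad_pos : ∀ (Y : Config s d (UnitAddTorus d)) (i : Fin s) (w : EuclideanSpace ℝ d),
      Function.update Y i ((Y i).1, w) ∈ Sbad ↔ Y ∈ Sbad := by
    intro Y i w
    have hfst : ∀ k : Fin s, ((Function.update Y i ((Y i).1, w)) k).1 = (Y k).1 := by
      intro k
      by_cases hk : k = i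
      · subst hk; simp
      · simp [Function.update_of_ne hk]
    rw [hSbad]
    simp only [mem_setOf_eq, hfst]
  /- ### the cut-off, the series and the potential -/
  obtain ⟨θ, hθ⟩ : ∃ θ : EuclideanSpace ℝ d → ℝ, θ = fun u => if 1 ≤ ‖u‖ ∧ ‖u‖ ≤ 2 then mσ⁻¹ else 0 :=
    ⟨_, rfl⟩
  have hθm : Measurable θ := by
    rw [hθ]
    refine Measurable.ite ?_ measurable_const measurable_const
    exact (measurableSet_le measurable_const measurable_norm).inter (measurableSet_le measurable_norm measurable_const)
  have hθ0 : ∀ u, 0 ≤ θ u := fun u => by rw [hθ]; simp only; split_ifs <;> [positivity; exact le_rfl]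
  have hθle : ∀ u, θ u ≤ mσ⁻¹ := fun u => by rw [hθ]; simp only; split_ifs <;> [exact le_rfl; positivity]
  have hθsupp : ∀ u, θ u ≠ 0 → 1 ≤ ‖u‖ ∧ ‖u‖ ≤ 2 := fun u h => by
    rw [hθ] at h; simp only at h; by_contra hc'; exact h (if_neg hc')
  obtain ⟨Ser, hSer⟩ : ∃ Ser : Config s d (UnitAddTorus d) × EuclideanSpace ℝ d → ℝ, Ser = fun p =>
      {q : Config s d (UnitAddTorus d) × EuclideanSpace ℝ d | 1 ≤ ‖q.2‖}.indicator
        (fun q => ∑' n : ℕ, K (Function.update q.1 i₀ ((q.1 i₀).1, (q.1 i₀).2 + (n : ℝ) • q.2))) p := ⟨_, rfl⟩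
  have hSerm : Measurable Ser := by rw [hSer]; exact measurable_tsum_shift_series hb hKm hK
  have hSer_eq : ∀ (Y : Config s d (UnitAddTorus d)) (u : EuclideanSpace ℝ d), 1 ≤ ‖u‖ →
      Ser (Y, u) = ∑' n : ℕ, K (Function.update Y i₀ ((Y i₀).1, (Y i₀).2 + (n : ℝ) • u)) := by
    intro Y u hu
    rw [hSer]
    exact indicator_of_mem (show (Y, u) ∈ {q : Config s d (UnitAddTorus d) × EuclideanSpace ℝ d | 1 ≤ ‖q.2‖} from hu) _
  -- the uniform bound
  obtain ⟨Cb, hCb⟩ : ∃ Cb : ℝ, Cb = A₀ * (2 * ∑' k : ℕ, Real.exp (-b * (k : ℝ) ^ 2)) := ⟨_, rfl⟩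
  have hCb0 : 0 ≤ Cb := by
    rw [hCb]
    have hA₀ : 0 ≤ A₀ := by
      have Y₀ : Config s d (UnitAddTorus d) := fun _ => (0, 0)
      have h := hK Y₀
      have h2 : 0 < Real.exp (-b * ‖(Y₀ i₀).2‖ ^ 2) := Real.exp_pos _
      nlinarith [abs_nonneg (K Y₀)]
    have : 0 ≤ ∑' k : ℕ, Real.exp (-b * (k : ℝ) ^ 2) := tsum_nonneg fun _ => (Real.exp_pos _).le
    positivity
  have hSer_bd : ∀ (Y : Config s d (UnitAddTorus d)) (u : EuclideanSpace ℝ d), |Ser (Y, u)| ≤ Cb := by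
    intro Y u
    by_cases hu : 1 ≤ ‖u‖
    · rw [hSer_eq Y u hu]
      obtain ⟨hs1, hs2, hs3⟩ := summable_shift_series hb hK Y hu (i₀ := i₀)
      calc |∑' n : ℕ, K (Function.update Y i₀ ((Y i₀).1, (Y i₀).2 + (n : ℝ) • u))|
          ≤ ∑' n : ℕ, |K (Function.update Y i₀ ((Y i₀).1, (Y i₀).2 + (n : ℝ) • u))| := by
            have := norm_tsum_le_tsum_norm (f := fun n : ℕ => K (Function.update Y i₀ ((Y i₀).1, (Y i₀).2 + (n : ℝ) • u)))
              (by simpa [Real.norm_eq_abs] using hs2)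
            simpa [Real.norm_eq_abs] using this
        _ ≤ Cb := by rw [hCb]; exact hs3
    · rw [hSer]
      simp only
      rw [indicator_of_notMem (show (Y, u) ∉ {q : Config s d (UnitAddTorus d) × EuclideanSpace ℝ d | 1 ≤ ‖q.2‖} from hu)]
      simpa using hCb0
  obtain ⟨Λ, hΛ⟩ : ∃ Λ : Config s d (UnitAddTorus d) → EuclideanSpace ℝ d → ℝ, Λ = fun Y u =>
      -(θ u / c) * Ser (Y, u) := ⟨_, rfl⟩
  have hΛ_bd : ∀ Y u, |Λ Y u| ≤ θ u / c * Cb := fun Y u => by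
    rw [hΛ]; simp only
    rw [abs_mul, abs_neg, abs_of_nonneg (div_nonneg (hθ0 u) hc0.le)]
    exact mul_le_mul_of_nonneg_left (hSer_bd Y u) (div_nonneg (hθ0 u) hc0.le)
  have hΛ_zero : ∀ Y u, θ u = 0 → Λ Y u = 0 := fun Y u h => by rw [hΛ]; simp [h]
  -- telescoping
  have hΛ_tel : ∀ (Y : Config s d (UnitAddTorus d)) (u : EuclideanSpace ℝ d),
      Λ (Function.update Y i₀ ((Y i₀).1, (Y i₀).2 + u)) u - Λ Y u = θ u * K Y / c := by
    intro Y u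
    by_cases hθu : θ u = 0
    · rw [hΛ_zero _ _ hθu, hΛ_zero _ _ hθu, hθu]; ring
    have hu : 1 ≤ ‖u‖ := (hθsupp u hθu).1
    have h1 : Ser (Function.update Y i₀ ((Y i₀).1, (Y i₀).2 + u), u) =
        ∑' n : ℕ, K (Function.update Y i₀ ((Y i₀).1, (Y i₀).2 + (n : ℝ) • u)) - K Y := by
      rw [hSer_eq _ u hu]
      simp only [update_vel_add_update]
      exact tsum_shift_series_succ hb hK Y hu
    rw [hΛ]; simp only
    rw [h1, hSer_eq Y u hu]
    ring
  /- ### the boundary data -/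
  obtain ⟨hbd, hhbd⟩ : ∃ hbd : Config (s + 1) d (UnitAddTorus d) → ℝ, hbd = fun Z =>
      if ‖ε⁻¹ • Torus.reprSym ((Z (Fin.last s)).1 - (Z (Fin.castSucc i₀)).1)‖ = 1 ∧
          0 < ⟪ε⁻¹ • Torus.reprSym ((Z (Fin.last s)).1 - (Z (Fin.castSucc i₀)).1), (Z (Fin.castSucc i₀)).2 - (Z (Fin.last s)).2⟫_ℝ ∧
          (fun k : Fin s => Z (Fin.castSucc k)) ∉ Sbad then
        Λ (fun k : Fin s => Z (Fin.castSucc k))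
            (⟪ε⁻¹ • Torus.reprSym ((Z (Fin.last s)).1 - (Z (Fin.castSucc i₀)).1), (Z (Fin.castSucc i₀)).2 - (Z (Fin.last s)).2⟫_ℝ •
              (ε⁻¹ • Torus.reprSym ((Z (Fin.last s)).1 - (Z (Fin.castSucc i₀)).1))) *
          Real.exp (-(‖(Z (Fin.last s)).2 - (Z (Fin.castSucc i₀)).2‖ ^ 2 -
            ⟪ε⁻¹ • Torus.reprSym ((Z (Fin.last s)).1 - (Z (Fin.castSucc i₀)).1), (Z (Fin.castSucc i₀)).2 - (Z (Fin.last s)).2⟫_ℝ ^ 2)) /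
          (⟪ε⁻¹ • Torus.reprSym ((Z (Fin.last s)).1 - (Z (Fin.castSucc i₀)).1), (Z (Fin.castSucc i₀)).2 - (Z (Fin.last s)).2⟫_ℝ * M)
      else 0 := ⟨_, rfl⟩
  refine ⟨hbd, ?_, ?_⟩
  swap
  · /- ### support -/
    intro Z hZ
    rw [hhbd] at hZ
    simp only at hZ
    split_ifs at hZ with hcond
    · have h1 := hcond.1
      rw [norm_smul, Real.norm_eq_abs, abs_inv, abs_of_pos hε] at h1
      have : ‖Torus.reprSym ((Z (Fin.last s)).1 - (Z (Fin.castSucc i₀)).1)‖ = ε := by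
        field_simp at h1; linarith [h1]
      exact this
    · exact absurd rfl hZ
  /- ### reads of the data at the collision configurations -/
  -- good directions
  have hgoodω : ∀ ω : sphere (0 : EuclideanSpace ℝ d) 1,
      Torus.reprSym (Literature.Analysis.FunctionSpaces.Torus.proj (ε • (ω : EuclideanSpace ℝ d))) = ε • (ω : EuclideanSpace ℝ d) →
      ∀ x₀ : UnitAddTorus d, ε⁻¹ • Torus.reprSym ((Torus.geometry d).translate x₀ (ε • (ω : EuclideanSpace ℝ d)) - x₀) = ω := by
    intro ω hω x₀
    rw [reprSym_translate_sub x₀ hω, smul_smul, inv_mul_cancel₀ hε.ne', one_smul]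
  have hωunit : ∀ ω : sphere (0 : EuclideanSpace ℝ d) 1, ‖(ω : EuclideanSpace ℝ d)‖ = 1 := fun ω => by simp
  have hωinner : ∀ ω : sphere (0 : EuclideanSpace ℝ d) 1, ⟪(ω : EuclideanSpace ℝ d), (ω : EuclideanSpace ℝ d)⟫_ℝ = 1 := fun ω => by
    rw [real_inner_self_eq_norm_sq, hωunit, one_pow]
  -- loss configurations of the pair `(i₀, s+1)`
  have hloss : ∀ (Y : Config s d (UnitAddTorus d)) (ω : sphere (0 : EuclideanSpace ℝ d) 1),
      Torus.reprSym (Literature.Analysis.FunctionSpaces.Torus.proj (ε • (ω : EuclideanSpace ℝ d))) = ε • (ω : EuclideanSpace ℝ d) →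
      ∀ v : EuclideanSpace ℝ d,
      hbd (lossConfig (Torus.geometry d) ε Y i₀ ω v) =
        if 0 < ⟪(ω : EuclideanSpace ℝ d), (Y i₀).2 - v⟫_ℝ ∧ Y ∉ Sbad then
          Λ Y (⟪(ω : EuclideanSpace ℝ d), (Y i₀).2 - v⟫_ℝ • (ω : EuclideanSpace ℝ d)) *
            Real.exp (-(‖v - (Y i₀).2‖ ^ 2 - ⟪(ω : EuclideanSpace ℝ d), (Y i₀).2 - v⟫_ℝ ^ 2)) /
            (⟪(ω : EuclideanSpace ℝ d), (Y i₀).2 - v⟫_ℝ * M)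
        else 0 := by
    intro Y ω hω v
    have hY : (fun k : Fin s => lossConfig (Torus.geometry d) ε Y i₀ ω v (Fin.castSucc k)) = Y := by
      funext k; exact appendParticle_apply_castSucc _ _ _ k
    have hlast : lossConfig (Torus.geometry d) ε Y i₀ ω v (Fin.last s) =
        ((Torus.geometry d).translate (Y i₀).1 (ε • (ω : EuclideanSpace ℝ d)), v) := appendParticle_apply_last _ _ _
    have hi₀ : lossConfig (Torus.geometry d) ε Y i₀ ω v (Fin.castSucc i₀) = Y i₀ := appendParticle_apply_castSucc _ _ _ i₀
    rw [hhbd]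
    simp only [hY, hlast, hi₀, hgoodω ω hω, hωunit, true_and]
  -- gain configurations of the pair `(i₀, s+1)`
  have hgain : ∀ (Y : Config s d (UnitAddTorus d)) (ω : sphere (0 : EuclideanSpace ℝ d) 1),
      Torus.reprSym (Literature.Analysis.FunctionSpaces.Torus.proj (ε • (ω : EuclideanSpace ℝ d))) = ε • (ω : EuclideanSpace ℝ d) →
      ∀ v : EuclideanSpace ℝ d,
      hbd (gainConfig (Torus.geometry d) ε Y i₀ ω v) =
        if 0 < ⟪(ω : EuclideanSpace ℝ d), v - (Y i₀).2⟫_ℝ ∧ Y ∉ Sbad then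
          Λ (Function.update Y i₀ ((Y i₀).1, (Y i₀).2 + ⟪(ω : EuclideanSpace ℝ d), v - (Y i₀).2⟫_ℝ • (ω : EuclideanSpace ℝ d)))
              (⟪(ω : EuclideanSpace ℝ d), v - (Y i₀).2⟫_ℝ • (ω : EuclideanSpace ℝ d)) *
            Real.exp (-(‖v - (Y i₀).2‖ ^ 2 - ⟪(ω : EuclideanSpace ℝ d), v - (Y i₀).2⟫_ℝ ^ 2)) /
            (⟪(ω : EuclideanSpace ℝ d), v - (Y i₀).2⟫_ℝ * M)
        else 0 := by
    intro Y ω hω v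
    have hrv := reflectVel_unit (ω : EuclideanSpace ℝ d) (hωunit ω) (Y i₀).2 v
    have hY : (fun k : Fin s => gainConfig (Torus.geometry d) ε Y i₀ ω v (Fin.castSucc k)) =
        Function.update Y i₀ ((Y i₀).1, (Y i₀).2 + ⟪(ω : EuclideanSpace ℝ d), v - (Y i₀).2⟫_ℝ • (ω : EuclideanSpace ℝ d)) := by
      funext k
      rw [gainConfig, appendParticle_apply_castSucc, hrv]
    have hlast : gainConfig (Torus.geometry d) ε Y i₀ ω v (Fin.last s) =
        ((Torus.geometry d).translate (Y i₀).1 (ε • (ω : EuclideanSpace ℝ d)),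
          v - ⟪(ω : EuclideanSpace ℝ d), v - (Y i₀).2⟫_ℝ • (ω : EuclideanSpace ℝ d)) := by
      rw [gainConfig, appendParticle_apply_last, hrv]
    have hi₀ : gainConfig (Torus.geometry d) ε Y i₀ ω v (Fin.castSucc i₀) =
        ((Y i₀).1, (Y i₀).2 + ⟪(ω : EuclideanSpace ℝ d), v - (Y i₀).2⟫_ℝ • (ω : EuclideanSpace ℝ d)) := by
      rw [gainConfig, appendParticle_apply_castSucc, hrv, Function.update_self]
    -- the scalar `r` of the gain configuration is `⟪ω, v - v₀⟫`
    have hr : ⟪(ω : EuclideanSpace ℝ d), ((Y i₀).2 + ⟪(ω : EuclideanSpace ℝ d), v - (Y i₀).2⟫_ℝ • (ω : EuclideanSpace ℝ d)) -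
        (v - ⟪(ω : EuclideanSpace ℝ d), v - (Y i₀).2⟫_ℝ • (ω : EuclideanSpace ℝ d))⟫_ℝ =
        ⟪(ω : EuclideanSpace ℝ d), v - (Y i₀).2⟫_ℝ := by
      have : (Y i₀).2 + ⟪(ω : EuclideanSpace ℝ d), v - (Y i₀).2⟫_ℝ • (ω : EuclideanSpace ℝ d) -
          (v - ⟪(ω : EuclideanSpace ℝ d), v - (Y i₀).2⟫_ℝ • (ω : EuclideanSpace ℝ d)) =
          (2 * ⟪(ω : EuclideanSpace ℝ d), v - (Y i₀).2⟫_ℝ) • (ω : EuclideanSpace ℝ d) - (v - (Y i₀).2) := by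
        rw [mul_smul, two_smul]; abel
      rw [this, inner_sub_right, real_inner_smul_right, hωinner]
      ring
    -- the Gaussian exponent of the gain configuration
    have hexp : ‖(v - ⟪(ω : EuclideanSpace ℝ d), v - (Y i₀).2⟫_ℝ • (ω : EuclideanSpace ℝ d)) -
        ((Y i₀).2 + ⟪(ω : EuclideanSpace ℝ d), v - (Y i₀).2⟫_ℝ • (ω : EuclideanSpace ℝ d))‖ ^ 2 =
        ‖v - (Y i₀).2‖ ^ 2 := by
      have : (v - ⟪(ω : EuclideanSpace ℝ d), v - (Y i₀).2⟫_ℝ • (ω : EuclideanSpace ℝ d)) -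
          ((Y i₀).2 + ⟪(ω : EuclideanSpace ℝ d), v - (Y i₀).2⟫_ℝ • (ω : EuclideanSpace ℝ d)) =
          (v - (Y i₀).2) - (2 * ⟪(ω : EuclideanSpace ℝ d), v - (Y i₀).2⟫_ℝ) • (ω : EuclideanSpace ℝ d) := by
        rw [mul_smul, two_smul]; abel
      rw [this, norm_sub_sq_real, norm_smul, Real.norm_eq_abs, hωunit, mul_one, real_inner_smul_right,
        real_inner_comm, sq_abs]
      ring
    rw [hhbd]
    simp only [hY, hlast, hi₀, hgoodω ω hω, hωunit, true_and, hr, hexp, hSbad_pos]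
  /- ### the collision term of the pair `(i₀, s+1)` -/
  have hmain : ∀ (Y : Config s d (UnitAddTorus d)) (ω : sphere (0 : EuclideanSpace ℝ d) 1),
      Torus.reprSym (Literature.Analysis.FunctionSpaces.Torus.proj (ε • (ω : EuclideanSpace ℝ d))) = ε • (ω : EuclideanSpace ℝ d) →
      ∫ v : EuclideanSpace ℝ d,
          (max ⟪(ω : EuclideanSpace ℝ d), v - (Y i₀).2⟫_ℝ 0 * hbd (gainConfig (Torus.geometry d) ε Y i₀ ω v) -
            max (-⟪(ω : EuclideanSpace ℝ d), v - (Y i₀).2⟫_ℝ) 0 * hbd (lossConfig (Torus.geometry d) ε Y i₀ ω v)) =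
        Sbadᶜ.indicator K Y / (c * mσ) := by
    intro Y ω hω
    by_cases hYS : Y ∈ Sbad
    · -- all reads vanish
      rw [indicator_of_notMem (show Y ∉ Sbadᶜ from fun h => h hYS), zero_div]
      refine integral_eq_zero_of_ae (Eventually.of_forall fun v => ?_)
      simp only [Pi.zero_apply]
      rw [hgain Y ω hω v, hloss Y ω hω v, if_neg (fun h => h.2 hYS), if_neg (fun h => h.2 hYS)]
      ring
    rw [indicator_of_mem (show Y ∈ Sbadᶜ from hYS)]
    -- abbreviations
    have hYS' : Y ∉ Sbad := hYS
    have hupd : Measurable fun a : ℝ => Function.update Y i₀ ((Y i₀).1, (Y i₀).2 + a • (ω : EuclideanSpace ℝ d)) := by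
      refine measurable_pi_lambda _ fun k => ?_
      by_cases hk : k = i₀
      · subst hk
        simp only [Function.update_self]
        exact measurable_const.prodMk (measurable_const.add (measurable_id.smul_const _))
      · simp only [Function.update_of_ne hk]
        exact measurable_const
    -- the two profiles
    obtain ⟨FG, hFG⟩ : ∃ FG : ℝ → ℝ, FG = fun a => if 0 < a then
        Λ (Function.update Y i₀ ((Y i₀).1, (Y i₀).2 + a • (ω : EuclideanSpace ℝ d))) (a • (ω : EuclideanSpace ℝ d)) / M
        else 0 := ⟨_, rfl⟩
    obtain ⟨FL, hFL⟩ : ∃ FL : ℝ → ℝ, FL = fun a => if 0 < a then Λ Y (a • (ω : EuclideanSpace ℝ d)) / M else 0 := ⟨_, rfl⟩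
    have hFGm : Measurable FG := by
      rw [hFG, hΛ]
      refine Measurable.ite measurableSet_Ioi ?_ measurable_const
      refine Measurable.div_const ?_ _
      refine ((hθm.comp (measurable_id.smul_const _)).div_const _).neg.mul ?_
      exact hSerm.comp (hupd.prodMk (measurable_id.smul_const _))
    have hFLm : Measurable FL := by
      rw [hFL, hΛ]
      refine Measurable.ite measurableSet_Ioi ?_ measurable_const
      refine Measurable.div_const ?_ _
      refine ((hθm.comp (measurable_id.smul_const _)).div_const _).neg.mul ?_
      exact hSerm.comp (measurable_const.prodMk (measurable_id.smul_const _))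
    -- bounds and supports
    have hθa : ∀ a : ℝ, 0 < a → θ (a • (ω : EuclideanSpace ℝ d)) = if 1 ≤ a ∧ a ≤ 2 then mσ⁻¹ else 0 := by
      intro a ha
      rw [hθ]; simp only
      rw [norm_smul, Real.norm_eq_abs, abs_of_pos ha, hωunit, mul_one]
    have hbound : ∀ (Y' : Config s d (UnitAddTorus d)) (a : ℝ), 0 < a →
        |Λ Y' (a • (ω : EuclideanSpace ℝ d)) / M| ≤ (Icc (1 : ℝ) 2).indicator (fun _ => mσ⁻¹ / c * Cb / M) a := by
      intro Y' a ha
      have h1 := hΛ_bd Y' (a • (ω : EuclideanSpace ℝ d))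
      rw [hθa a ha] at h1
      by_cases hI : a ∈ Icc (1 : ℝ) 2
      · rw [indicator_of_mem hI, abs_div, abs_of_pos hM0]
        rw [if_pos ⟨hI.1, hI.2⟩] at h1
        exact div_le_div_of_nonneg_right h1 hM0.le
      · rw [indicator_of_notMem hI]
        rw [if_neg (fun h => hI ⟨h.1, h.2⟩), zero_div, zero_mul] at h1
        have : Λ Y' (a • (ω : EuclideanSpace ℝ d)) = 0 := abs_eq_zero.1 (le_antisymm h1 (abs_nonneg _))
        rw [this, zero_div, abs_zero]
    have hIi : Integrable ((Icc (1 : ℝ) 2).indicator fun _ : ℝ => mσ⁻¹ / c * Cb / M) := by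
      refine IntegrableOn.integrable_indicator ?_ measurableSet_Icc
      exact (continuous_const.integrableOn_Icc (μ := volume) (a := (1 : ℝ)) (b := 2))
    have hFGi : Integrable FG := by
      refine Integrable.mono' hIi hFGm.aestronglyMeasurable (Eventually.of_forall fun a => ?_)
      rw [Real.norm_eq_abs, hFG]
      simp only
      split_ifs with ha
      · exact hbound _ a ha
      · rw [abs_zero]
        exact indicator_nonneg (fun _ _ => div_nonneg (mul_nonneg (div_nonneg (inv_nonneg.2 hmσ0.le) hc0.le) hCb0) hM0.le) _
    have hFLi : Integrable FL := by
      refine Integrable.mono' hIi hFLm.aestronglyMeasurable (Eventually.of_forall fun a => ?_)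
      rw [Real.norm_eq_abs, hFL]
      simp only
      split_ifs with ha
      · exact hbound _ a ha
      · rw [abs_zero]
        exact indicator_nonneg (fun _ _ => div_nonneg (mul_nonneg (div_nonneg (inv_nonneg.2 hmσ0.le) hc0.le) hCb0) hM0.le) _
    -- the pointwise form of the integrand
    have hpt : ∀ v : EuclideanSpace ℝ d,
        max ⟪(ω : EuclideanSpace ℝ d), v - (Y i₀).2⟫_ℝ 0 * hbd (gainConfig (Torus.geometry d) ε Y i₀ ω v) -
          max (-⟪(ω : EuclideanSpace ℝ d), v - (Y i₀).2⟫_ℝ) 0 * hbd (lossConfig (Torus.geometry d) ε Y i₀ ω v) =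
        (FG ⟪(ω : EuclideanSpace ℝ d), v - (Y i₀).2⟫_ℝ - FL (-⟪(ω : EuclideanSpace ℝ d), v - (Y i₀).2⟫_ℝ)) *
          Real.exp (-(‖v - (Y i₀).2‖ ^ 2 - ⟪(ω : EuclideanSpace ℝ d), v - (Y i₀).2⟫_ℝ ^ 2)) := by
      intro v
      have hneg : ⟪(ω : EuclideanSpace ℝ d), (Y i₀).2 - v⟫_ℝ = -⟪(ω : EuclideanSpace ℝ d), v - (Y i₀).2⟫_ℝ := by
        rw [← inner_neg_right, neg_sub]
      rw [hgain Y ω hω v, hloss Y ω hω v, hFG, hFL]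
      simp only [hneg, hYS', not_false_eq_true, and_true, even_two, Even.neg_pow]
      by_cases ha : 0 < ⟪(ω : EuclideanSpace ℝ d), v - (Y i₀).2⟫_ℝ
      · have hna : ¬ (0 < -⟪(ω : EuclideanSpace ℝ d), v - (Y i₀).2⟫_ℝ) := by linarith
        have ha0 : ⟪(ω : EuclideanSpace ℝ d), v - (Y i₀).2⟫_ℝ ≠ 0 := ha.ne'
        rw [if_pos ha, if_pos ha, if_neg hna, if_neg hna, max_eq_left ha.le, max_eq_right (by linarith)]
        field_simp
        ring
      · have hmax : max ⟪(ω : EuclideanSpace ℝ d), v - (Y i₀).2⟫_ℝ 0 = 0 := max_eq_right (not_lt.1 ha)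
        rw [if_neg ha, if_neg ha, hmax]
        by_cases hb' : 0 < -⟪(ω : EuclideanSpace ℝ d), v - (Y i₀).2⟫_ℝ
        · have ha0 : ⟪(ω : EuclideanSpace ℝ d), v - (Y i₀).2⟫_ℝ ≠ 0 := by
            intro h0; rw [h0, neg_zero] at hb'; exact lt_irrefl _ hb'
          rw [if_pos hb', if_pos hb', max_eq_left hb'.le]
          field_simp
          ring
        · rw [if_neg hb', if_neg hb', max_eq_right (not_lt.1 hb')]
          ring
    -- cylindrical coordinates
    have haxis := integral_axis_eq hm' (ω : EuclideanSpace ℝ d) (hωunit ω) (Y i₀).2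
      (F := fun a => FG a - FL (-a)) (hFGm.sub (hFLm.comp measurable_neg))
    simp only [hpt]
    rw [haxis, ← hM]
    -- the one-dimensional integral
    have hFLn : Integrable (fun a : ℝ => FL (-a)) := hFLi.comp_neg
    rw [integral_sub hFGi hFLn, integral_neg_eq_self (fun a => FL a) volume, ← integral_sub hFGi hFLi]
    -- telescoping
    have htel : ∀ a : ℝ, FG a - FL a = (Icc (1 : ℝ) 2).indicator (fun _ => K Y / (c * M) * mσ⁻¹) a := by
      intro a
      rw [hFG, hFL]
      simp only
      by_cases ha : 0 < a
      · rw [if_pos ha, if_pos ha, ← sub_div, hΛ_tel Y (a • (ω : EuclideanSpace ℝ d)), hθa a ha]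
        by_cases hI : a ∈ Icc (1 : ℝ) 2
        · rw [indicator_of_mem hI, if_pos ⟨hI.1, hI.2⟩]
          field_simp
        · rw [indicator_of_notMem hI, if_neg (fun h => hI ⟨h.1, h.2⟩)]
          simp
      · rw [if_neg ha, if_neg ha, sub_zero, indicator_of_notMem]
        rintro ⟨h1, -⟩
        exact ha (by linarith)
    simp only [htel]
    rw [integral_indicator_const _ measurableSet_Icc, Real.volume_real_Icc_of_le (by norm_num : (1 : ℝ) ≤ 2),
      smul_eq_mul]
    field_simp
    ring
  /- ### the collision terms of the other pairs -/
  have hcross : ∀ (Y : Config s d (UnitAddTorus d)) (i : Fin s), i ≠ i₀ → Y ∉ Sbad →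
      hsCollisionTerm (Torus.geometry d) ε s i hbd Y = 0 := by
    intro Y i hi hY
    have hσ0 : sphereMeasure {ω : sphere (0 : EuclideanSpace ℝ d) 1 |
        Torus.euclidDist ((Torus.geometry d).translate (Y i).1 (ε • (ω : EuclideanSpace ℝ d))) (Y i₀).1 = ε} = 0 := by
      by_contra hne
      apply hY
      rw [hSbad]
      exact ⟨i, hi, hne⟩
    have h0 : ∀ ω : sphere (0 : EuclideanSpace ℝ d) 1,
        Torus.euclidDist ((Torus.geometry d).translate (Y i).1 (ε • (ω : EuclideanSpace ℝ d))) (Y i₀).1 ≠ ε →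
        (∀ v : EuclideanSpace ℝ d, hbd (gainConfig (Torus.geometry d) ε Y i ω v) = 0) ∧
        (∀ v : EuclideanSpace ℝ d, hbd (lossConfig (Torus.geometry d) ε Y i ω v) = 0) := by
      intro ω hω
      have hnorm : ‖ε⁻¹ • Torus.reprSym ((Torus.geometry d).translate (Y i).1 (ε • (ω : EuclideanSpace ℝ d)) - (Y i₀).1)‖ ≠ 1 := by
        rw [norm_smul, Real.norm_eq_abs, abs_inv, abs_of_pos hε]
        intro h1
        apply hω
        have h2 : ‖Torus.reprSym ((Torus.geometry d).translate (Y i).1 (ε • (ω : EuclideanSpace ℝ d)) - (Y i₀).1)‖ = ε := by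
          field_simp at h1
          linarith
        exact h2
      constructor
      · intro v
        have hlast : gainConfig (Torus.geometry d) ε Y i ω v (Fin.last s) =
            ((Torus.geometry d).translate (Y i).1 (ε • (ω : EuclideanSpace ℝ d)),
              (reflectVel (ω : EuclideanSpace ℝ d) ((Y i).2, v)).2) := by
          rw [gainConfig, appendParticle_apply_last]
        have hi₀ : gainConfig (Torus.geometry d) ε Y i ω v (Fin.castSucc i₀) = Y i₀ := by
          rw [gainConfig, appendParticle_apply_castSucc, Function.update_of_ne (Ne.symm hi)]
        rw [hhbd]
        simp only [hlast, hi₀]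
        split_ifs with hc'
        · exact (hnorm hc'.1).elim
        · rfl
      · intro v
        have hlast : lossConfig (Torus.geometry d) ε Y i ω v (Fin.last s) =
            ((Torus.geometry d).translate (Y i).1 (ε • (ω : EuclideanSpace ℝ d)), v) := appendParticle_apply_last _ _ _
        have hi₀ : lossConfig (Torus.geometry d) ε Y i ω v (Fin.castSucc i₀) = Y i₀ := appendParticle_apply_castSucc _ _ _ i₀
        rw [hhbd]
        simp only [hlast, hi₀]
        split_ifs with hc'
        · exact (hnorm hc'.1).elim
        · rfl
    unfold hsCollisionTerm
    refine integral_eq_zero_of_ae ?_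
    rw [Filter.EventuallyEq, ae_iff]
    refine measure_mono_null (fun ω hω => ?_) hσ0
    simp only [mem_setOf_eq] at hω ⊢
    by_contra hne
    apply hω
    obtain ⟨hg0, hl0⟩ := h0 ω hne
    simp only [hg0, hl0, mul_zero, sub_zero, integral_zero, Pi.zero_apply]
  have hbad : ∀ (Y : Config s d (UnitAddTorus d)) (i : Fin s), Y ∈ Sbad →
      hsCollisionTerm (Torus.geometry d) ε s i hbd Y = 0 := by
    intro Y i hY
    have hg0 : ∀ (ω : sphere (0 : EuclideanSpace ℝ d) 1) (v : EuclideanSpace ℝ d),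
        hbd (gainConfig (Torus.geometry d) ε Y i ω v) = 0 := by
      intro ω v
      have hYg : (fun k : Fin s => gainConfig (Torus.geometry d) ε Y i ω v (Fin.castSucc k)) =
          Function.update Y i ((Y i).1, (reflectVel (ω : EuclideanSpace ℝ d) ((Y i).2, v)).1) := by
        funext k; rw [gainConfig, appendParticle_apply_castSucc]
      have hg' : Function.update Y i ((Y i).1, (reflectVel (ω : EuclideanSpace ℝ d) ((Y i).2, v)).1) ∈ Sbad :=
        (hSbad_pos Y i _).2 hY
      rw [hhbd]
      simp only [hYg]
      split_ifs with hc'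
      · exact (hc'.2.2 hg').elim
      · rfl
    have hl0 : ∀ (ω : sphere (0 : EuclideanSpace ℝ d) 1) (v : EuclideanSpace ℝ d),
        hbd (lossConfig (Torus.geometry d) ε Y i ω v) = 0 := by
      intro ω v
      have hYl : (fun k : Fin s => lossConfig (Torus.geometry d) ε Y i ω v (Fin.castSucc k)) = Y :=
        funext fun k => appendParticle_apply_castSucc _ _ _ k
      rw [hhbd]
      simp only [hYl]
      split_ifs with hc'
      · exact (hc'.2.2 hY).elim
      · rfl
    unfold hsCollisionTerm
    simp only [hg0, hl0, mul_zero, sub_zero, integral_zero]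
  /- ### assembly -/
  intro Y
  rw [← hSbad]
  by_cases hY : Y ∈ Sbad
  · rw [indicator_of_notMem (show Y ∉ Sbadᶜ from fun h => h hY)]
    unfold bbgkyOp bbgkyCollisionOp
    exact Finset.sum_eq_zero fun i _ => by rw [hbad Y i hY, mul_zero]
  · rw [indicator_of_mem (show Y ∈ Sbadᶜ from hY)]
    unfold bbgkyOp bbgkyCollisionOp
    rw [Finset.sum_eq_single i₀ (fun i _ hi => by rw [hcross Y i hi hY, mul_zero]) (fun h => absurd (Finset.mem_univ _) h)]
    -- the `i₀` term
    have hterm : hsCollisionTerm (Torus.geometry d) ε s i₀ hbd Y = K Y / c := by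
      unfold hsCollisionTerm
      have hae : (fun ω : sphere (0 : EuclideanSpace ℝ d) 1 => ∫ v : EuclideanSpace ℝ d,
          (max ⟪(ω : EuclideanSpace ℝ d), v - (Y i₀).2⟫_ℝ 0 * hbd (gainConfig (Torus.geometry d) ε Y i₀ ω v) -
            max (-⟪(ω : EuclideanSpace ℝ d), v - (Y i₀).2⟫_ℝ) 0 * hbd (lossConfig (Torus.geometry d) ε Y i₀ ω v))) =ᵐ[sphereMeasure]
          fun _ => K Y / (c * mσ) := by
        rw [Filter.EventuallyEq, ae_iff]
        refine measure_mono_null (fun ω hω => ?_) hBadω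
        simp only [mem_setOf_eq] at hω ⊢
        intro hgood
        apply hω
        rw [hmain Y ω hgood, indicator_of_mem (show Y ∈ Sbadᶜ from hY)]
      rw [integral_congr_ae hae, integral_const, smul_eq_mul, ← hmσ]
      field_simp
    rw [hterm, hc]
    have hne : ((N - s : ℕ) : ℝ) * ε ^ (Fintype.card d - 1) ≠ 0 := by rw [← hc]; exact hc0.ne'
    rw [mul_comm, div_mul_cancel₀ _ hne]

end Torus

end

end Literature.MathematicalPhysics.KineticTheory
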